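import Literature.Geometry.Symplectic.ZeroCircleAdaptedChart
import Literature.Geometry.Symplectic.PfaffianEstimates
import HarnessLib

/-!
# Adapted tubular chart along an even zero circle with the POSITIVE sign

Topic `Geometry/Symplectic`; namespace `Literature.Geometry.Symplectic`.  Theorems only; no named
fact, no `sorry`.  Perutz 2006, proof of Lemma 3.1, step 1, last sentence ("composing with a
reflection we may take the sign to be `+`"): the adapted chart of
`IsEvenZeroCircle.exists_adaptedChart` has `1`-jet `∇(χ^*ω)_{θe₀}(W) = σ β(M(θ) x(W))` with
`σ = ±1`; precomposing `χ` with the orientation-reversing linear involution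
`ι(θ, x₁, x₂, x₃) = (−θ, x₂, x₁, x₃)` of the model (which preserves the tube and the axis and
satisfies `ι^*β₁ = −β₂`, `ι^*β₂ = −β₁`, `ι^*β₃ = −β₃`) changes `σ` to `−σ` and `M(θ)` to
`P M(−θ) P` (`P` the transposition of the first two normal coordinates), which is again a smooth
periodic symmetric block family `M⁺ ⊕ (m₃₃)` with `M⁺ > 0 > m₃₃`.  The main theorem
`IsEvenZeroCircle.exists_adaptedChart_pos` records the chart with `σ = 1`, the jet being stated
for the Fréchet derivative of `y ↦ (χ^*ω)(y)` (`zeroGradient_eq_fderiv_model`), the form used by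
the gluing `exists_axisGluing`.

## References

* T. Perutz, *Zero-sets of near-symplectic forms*, J. Symplectic Geom. 4 (2006), §3, proof of
  Lemma 3.1 (step 1). [Perutz2006]
* K. Honda, *Local properties of self-dual harmonic 2-forms on a 4-manifold*, J. reine angew.
  Math. 577 (2004), Thm. 5. [Honda2004LocalSD]
-/

noncomputable section

open scoped Manifold ContDiff Topology Real Matrix
open Set Function Filter Module Matrix Real Literature.Topology.FourManifolds
  Literature.Geometry.Kaehler

namespace Literature.Geometry.Symplectic

universe u

/-! ### The reflection `ι(θ, x₁, x₂, x₃) = (−θ, x₂, x₁, x₃)` -/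

/-- The reflection `ι` as a continuous linear map (existence with its coordinate formulas).
[cite: Perutz2006, §3 (proof of Lemma 3.1, step 1)] -/
theorem exists_hondaReflectCLM :
    ∃ ι : EuclideanSpace ℝ (Fin 4) →L[ℝ] EuclideanSpace ℝ (Fin 4),
      ∀ q, ι q 0 = -q 0 ∧ ι q 1 = q 2 ∧ ι q 2 = q 1 ∧ ι q 3 = q 3 := by
  refine ⟨-((EuclideanSpace.proj (0 : Fin 4)).smulRight (EuclideanSpace.single (0 : Fin 4) (1 : ℝ)))
    + (EuclideanSpace.proj (2 : Fin 4)).smulRight (EuclideanSpace.single (1 : Fin 4) (1 : ℝ))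
    + (EuclideanSpace.proj (1 : Fin 4)).smulRight (EuclideanSpace.single (2 : Fin 4) (1 : ℝ))
    + (EuclideanSpace.proj (3 : Fin 4)).smulRight (EuclideanSpace.single (3 : Fin 4) (1 : ℝ)),
    fun q ↦ ?_⟩
  simp

section Reflect

variable {ι : EuclideanSpace ℝ (Fin 4) →L[ℝ] EuclideanSpace ℝ (Fin 4)}
  (hι : ∀ q, ι q 0 = -q 0 ∧ ι q 1 = q 2 ∧ ι q 2 = q 1 ∧ ι q 3 = q 3)
include hι

/-- `ι` is an involution. [folklore] -/
theorem reflect_reflect (q : EuclideanSpace ℝ (Fin 4)) : ι (ι q) = q := by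
  obtain ⟨h0, h1, h2, h3⟩ := hι (ι q)
  obtain ⟨g0, g1, g2, g3⟩ := hι q
  ext i
  fin_cases i
  · show ι (ι q) 0 = q 0
    rw [h0, g0, neg_neg]
  · show ι (ι q) 1 = q 1
    rw [h1, g2]
  · show ι (ι q) 2 = q 2
    rw [h2, g1]
  · show ι (ι q) 3 = q 3
    rw [h3, g3]

/-- `ι` is injective. [folklore] -/
theorem reflect_injective : Injective ι := fun a b h ↦ by
  rw [← reflect_reflect hι a, h, reflect_reflect hι]

/-- `ι` reverses the axis: `ι(θ e₀) = −θ e₀`. [folklore] -/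
theorem reflect_hondaAxisPoint (θ : ℝ) : ι (hondaAxisPoint θ) = hondaAxisPoint (-θ) := by
  obtain ⟨h0, h1, h2, h3⟩ := hι (hondaAxisPoint θ)
  ext i
  fin_cases i
  · show ι (hondaAxisPoint θ) 0 = hondaAxisPoint (-θ) 0
    rw [h0, hondaAxisPoint_apply_zero, hondaAxisPoint_apply_zero]
  · show ι (hondaAxisPoint θ) 1 = hondaAxisPoint (-θ) 1
    rw [h1, show (2 : Fin 4) = (1 : Fin 3).succ from rfl, show (1 : Fin 4) = (0 : Fin 3).succ from rfl,
      hondaAxisPoint_apply_succ, hondaAxisPoint_apply_succ]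
  · show ι (hondaAxisPoint θ) 2 = hondaAxisPoint (-θ) 2
    rw [h2, show (2 : Fin 4) = (1 : Fin 3).succ from rfl, show (1 : Fin 4) = (0 : Fin 3).succ from rfl,
      hondaAxisPoint_apply_succ, hondaAxisPoint_apply_succ]
  · show ι (hondaAxisPoint θ) 3 = hondaAxisPoint (-θ) 3
    rw [h3, show (3 : Fin 4) = (2 : Fin 3).succ from rfl, hondaAxisPoint_apply_succ,
      hondaAxisPoint_apply_succ]

/-- `ι e₀ = −e₀`. [folklore] -/
theorem reflect_single : ι (EuclideanSpace.single 0 1) = -EuclideanSpace.single 0 1 := by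
  obtain ⟨h0, h1, h2, h3⟩ := hι (EuclideanSpace.single 0 1)
  ext i
  fin_cases i
  · show ι (EuclideanSpace.single 0 1) 0 = (-EuclideanSpace.single (0 : Fin 4) (1 : ℝ)) 0
    rw [h0]; simp
  · show ι (EuclideanSpace.single 0 1) 1 = (-EuclideanSpace.single (0 : Fin 4) (1 : ℝ)) 1
    rw [h1]; simp
  · show ι (EuclideanSpace.single 0 1) 2 = (-EuclideanSpace.single (0 : Fin 4) (1 : ℝ)) 2
    rw [h2]; simp
  · show ι (EuclideanSpace.single 0 1) 3 = (-EuclideanSpace.single (0 : Fin 4) (1 : ℝ)) 3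
    rw [h3]; simp

/-- `ι` is anti-equivariant under axis translations. [folklore] -/
theorem reflect_add_smul (q : EuclideanSpace ℝ (Fin 4)) (c : ℝ) :
    ι (q + c • EuclideanSpace.single 0 1) = ι q + (-c) • EuclideanSpace.single 0 1 := by
  rw [map_add, map_smul, reflect_single hι, smul_neg, neg_smul]

/-- `ι` preserves the tubes. [folklore] -/
theorem reflect_mem_hondaTube_iff {r : ℝ} {q : EuclideanSpace ℝ (Fin 4)} :
    ι q ∈ hondaTube r ↔ q ∈ hondaTube r := by
  obtain ⟨-, h1, h2, h3⟩ := hι q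
  rw [mem_hondaTube, mem_hondaTube, h1, h2, h3]
  constructor <;> intro h <;> linarith

/-- `ι` preserves the axis. [folklore] -/
theorem reflect_mem_hondaAxis_iff {q : EuclideanSpace ℝ (Fin 4)} :
    ι q ∈ hondaAxis ↔ q ∈ hondaAxis := by
  obtain ⟨-, h1, h2, h3⟩ := hι q
  rw [mem_hondaAxis, mem_hondaAxis, h1, h2, h3]
  tauto

/-- Images of `ι`-invariant sets under `χ ∘ ι`. [folklore] -/
theorem image_comp_reflect {α : Type*} (χ : EuclideanSpace ℝ (Fin 4) → α)
    {S : Set (EuclideanSpace ℝ (Fin 4))} (hS : ∀ q, ι q ∈ S ↔ q ∈ S) : (χ ∘ ι) '' S = χ '' S := by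
  ext x
  constructor
  · rintro ⟨q, hq, rfl⟩
    exact ⟨ι q, (hS q).2 hq, rfl⟩
  · rintro ⟨q, hq, rfl⟩
    refine ⟨ι q, (hS q).2 hq, ?_⟩
    simp only [Function.comp_apply, reflect_reflect hι]

/-- Normal coordinates of `ι W`: the first two are swapped. [folklore] -/
theorem normalPart_reflect (W : EuclideanSpace ℝ (Fin 4)) :
    normalPart (ι W) = normalPart W ∘ Equiv.swap (0 : Fin 3) 1 := by
  obtain ⟨-, h1, h2, h3⟩ := hι W
  funext k
  fin_cases k
  · show normalPart (ι W) 0 = normalPart W (Equiv.swap (0 : Fin 3) 1 0)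
    rw [Equiv.swap_apply_left, normalPart_apply, normalPart_apply]
    exact h1
  · show normalPart (ι W) 1 = normalPart W (Equiv.swap (0 : Fin 3) 1 1)
    rw [Equiv.swap_apply_right, normalPart_apply, normalPart_apply]
    exact h2
  · show normalPart (ι W) 2 = normalPart W (Equiv.swap (0 : Fin 3) 1 2)
    rw [Equiv.swap_apply_of_ne_of_ne (by decide) (by decide), normalPart_apply, normalPart_apply]
    exact h3

/-- **`ι^*β₁ = −β₂`, `ι^*β₂ = −β₁`, `ι^*β₃ = −β₃`.** [cite: Perutz2006, §3 (proof of Lemma 3.1, step 1)] -/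
theorem hondaBetaVec_reflect (U V : EuclideanSpace ℝ (Fin 4)) (k : Fin 3) :
    hondaBetaVec (ι U) (ι V) k = -hondaBetaVec U V (Equiv.swap (0 : Fin 3) 1 k) := by
  obtain ⟨hU0, hU1, hU2, hU3⟩ := hι U
  obtain ⟨hV0, hV1, hV2, hV3⟩ := hι V
  fin_cases k
  · show hondaBetaVec (ι U) (ι V) 0 = -hondaBetaVec U V (Equiv.swap (0 : Fin 3) 1 0)
    rw [Equiv.swap_apply_left]
    simp only [hondaBetaVec, Matrix.cons_val_zero, Matrix.cons_val_one,
      hondaBeta₁_apply, hondaBeta₂_apply, hU0, hU1, hU2, hU3, hV0, hV1, hV2, hV3]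
    ring
  · show hondaBetaVec (ι U) (ι V) 1 = -hondaBetaVec U V (Equiv.swap (0 : Fin 3) 1 1)
    rw [Equiv.swap_apply_right]
    simp only [hondaBetaVec, Matrix.cons_val_zero, Matrix.cons_val_one,
      hondaBeta₁_apply, hondaBeta₂_apply, hU0, hU1, hU2, hU3, hV0, hV1, hV2, hV3]
    ring
  · show hondaBetaVec (ι U) (ι V) 2 = -hondaBetaVec U V (Equiv.swap (0 : Fin 3) 1 2)
    rw [Equiv.swap_apply_of_ne_of_ne (by decide) (by decide)]
    simp only [hondaBetaVec, Matrix.cons_val_two, Matrix.tail_cons, Matrix.head_cons,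
      hondaBeta₃_apply, hU0, hU1, hU2, hU3, hV0, hV1, hV2, hV3]
    ring

/-- **`ι^* β(a) = −β(a ∘ P)`.** [cite: Perutz2006, §3 (proof of Lemma 3.1, step 1)] -/
theorem betaForm_compContinuousLinearMap_reflect (a : Fin 3 → ℝ) :
    (betaForm a).compContinuousLinearMap ι = -betaForm (a ∘ Equiv.swap (0 : Fin 3) 1) := by
  ext v
  have hv : v = ![v 0, v 1] := funext fun i ↦ by fin_cases i <;> rfl
  have hιv : (⇑ι) ∘ ![v 0, v 1] = ![ι (v 0), ι (v 1)] := funext fun i ↦ by fin_cases i <;> rfl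
  rw [ContinuousAlternatingMap.compContinuousLinearMap_apply, ContinuousAlternatingMap.neg_apply,
    hv, hιv, betaForm_apply, betaForm_apply]
  simp only [hondaBetaVec_reflect hι, Function.comp_apply, Fin.sum_univ_three,
    Equiv.swap_apply_left, Equiv.swap_apply_right,
    Equiv.swap_apply_of_ne_of_ne (show (2 : Fin 3) ≠ 0 by decide) (show (2 : Fin 3) ≠ 1 by decide)]
  ring

end Reflect

/-! ### The reflected block family `P M(−θ) P` -/

section Block

variable {Mb : ℝ → Matrix (Fin 3) (Fin 3) ℝ}

/-- Entries of the reflected family. [folklore] -/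
theorem reflectBlock_apply (θ : ℝ) (i j : Fin 3) :
    (Mb (-θ)).submatrix (Equiv.swap (0 : Fin 3) 1) (Equiv.swap (0 : Fin 3) 1) i j =
      Mb (-θ) (Equiv.swap (0 : Fin 3) 1 i) (Equiv.swap (0 : Fin 3) 1 j) := rfl

/-- The reflected family keeps the block structure. [folklore] -/
theorem reflectBlock_block (hblock : ∀ θ (m : Fin 3), Mb θ m 2 = if m = 2 then Mb θ 2 2 else 0)
    (θ : ℝ) (m : Fin 3) :
    (Mb (-θ)).submatrix (Equiv.swap (0 : Fin 3) 1) (Equiv.swap (0 : Fin 3) 1) m 2 =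
      if m = 2 then (Mb (-θ)).submatrix (Equiv.swap (0 : Fin 3) 1) (Equiv.swap (0 : Fin 3) 1) 2 2
      else 0 := by
  have h0 : Mb (-θ) 0 2 = 0 := by simpa using hblock (-θ) 0
  have h1 : Mb (-θ) 1 2 = 0 := by simpa using hblock (-θ) 1
  have hs2 : Equiv.swap (0 : Fin 3) 1 2 = 2 := Equiv.swap_apply_of_ne_of_ne (by decide) (by decide)
  fin_cases m
  · show (Mb (-θ)).submatrix _ _ 0 2 = _
    rw [reflectBlock_apply, Equiv.swap_apply_left, hs2, h1]; simp
  · show (Mb (-θ)).submatrix _ _ 1 2 = _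
    rw [reflectBlock_apply, Equiv.swap_apply_right, hs2, h0]; simp
  · show (Mb (-θ)).submatrix _ _ 2 2 = _
    simp

/-- The quadratic form of the reflected family on `{v₂ = 0}` is that of `M(−θ)` on the swapped
vector. [folklore] -/
theorem dotProduct_reflectBlock_mulVec (θ : ℝ) (v : Fin 3 → ℝ) :
    v ⬝ᵥ ((Mb (-θ)).submatrix (Equiv.swap (0 : Fin 3) 1) (Equiv.swap (0 : Fin 3) 1) *ᵥ v) =
      (v ∘ Equiv.swap (0 : Fin 3) 1) ⬝ᵥ (Mb (-θ) *ᵥ (v ∘ Equiv.swap (0 : Fin 3) 1)) := by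
  rw [Matrix.submatrix_mulVec_equiv, Equiv.symm_swap]
  have hs2 : Equiv.swap (0 : Fin 3) 1 2 = 2 := Equiv.swap_apply_of_ne_of_ne (by decide) (by decide)
  simp only [dotProduct, Fin.sum_univ_three, Function.comp_apply, Equiv.swap_apply_left,
    Equiv.swap_apply_right, hs2]
  ring

end Block

/-! ### The chart with the positive sign -/

variable {M : Type u} [TopologicalSpace M] [ChartedSpace (EuclideanSpace ℝ (Fin 4)) M]
  [IsManifold (𝓡 4) ∞ M] [T2Space M] [SigmaCompactSpace M]

omit [IsManifold (𝓡 4) ∞ M] [T2Space M] [SigmaCompactSpace M] in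
/-- **The `1`-jet of `χ^*ω` at the axis as a Fréchet derivative**: the conclusion of
`IsEvenZeroCircle.exists_adaptedChart` in the form `D(χ^*ω)_{θe₀}(W) = σ β(M(θ) x(W))`.
[cite: Perutz2006, §3 (proof of Lemma 3.1, step 1)] -/
theorem fderiv_pullback_axis_eq_of_zeroGradient {sf : MForm (𝓡 4) M ℝ 2}
    {χ : EuclideanSpace ℝ (Fin 4) → M} {σ : ℝ} {Mb : ℝ → Matrix (Fin 3) (Fin 3) ℝ}
    (hjet : ∀ θ W U V, zeroGradient (sf.pullback 𝓘(ℝ, EuclideanSpace ℝ (Fin 4)) χ)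
      (hondaAxisPoint θ) W ![U, V] = σ * ∑ k, (Mb θ *ᵥ normalPart W) k * hondaBetaVec U V k)
    (θ : ℝ) (W : EuclideanSpace ℝ (Fin 4)) :
    fderiv ℝ (fun y ↦ (sf.pullback 𝓘(ℝ, EuclideanSpace ℝ (Fin 4)) χ y :
      (EuclideanSpace ℝ (Fin 4)) [⋀^Fin 2]→L[ℝ] ℝ)) (hondaAxisPoint θ) W =
      betaForm (fun k ↦ σ * (Mb θ *ᵥ normalPart W) k) := by
  rw [← zeroGradient_eq_fderiv_model]
  ext v
  have hv : v = ![v 0, v 1] := funext fun i ↦ by fin_cases i <;> rfl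
  rw [hv, hjet, betaForm_apply, Finset.mul_sum]
  exact Finset.sum_congr rfl fun k _ ↦ by ring

/-- `β(−a) = −β(a)`. [folklore] -/
theorem betaForm_neg (a : Fin 3 → ℝ) : betaForm (-a) = -betaForm a := by
  rw [← zero_sub, betaForm_sub, betaForm_zero, zero_sub]

set_option maxHeartbeats 1600000 in
/-- **Adapted tubular chart along an even zero circle, positive sign** (Perutz 2006, proof of
Lemma 3.1, step 1, "composing with a reflection"): for a strictly near-symplectic `sf` and an
even zero circle `γ` inside an open `N`, a `2π`-periodic tubular chart `χ` of some tube
`hondaTube r` — smooth, immersive, injective modulo `2πℤ e₀`, with image in `N`, axis image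
`γ(ℝ)`, and meeting the zero locus exactly along the axis — together with a smooth `2π`-periodic
symmetric block family `M(θ) = M⁺(θ) ⊕ (m₃₃(θ))`, `M⁺ > 0 > m₃₃`, such that
`D(χ^*ω)_{θe₀}(W) = β(M(θ) x(W))` (sign `+`). [cite: Perutz2006, Lemma 3.1 (proof, step 1)] -/
theorem IsEvenZeroCircle.exists_adaptedChart_pos (o : SmoothOrientation (𝓡 4) M)
    {sf : MForm (𝓡 4) M ℝ 2} {γ : ℝ → M} (hsf : IsStrictlyNearSymplectic o sf)
    (h : IsEvenZeroCircle sf γ) {N : Set M} (hN : IsOpen N) (hγN : range γ ⊆ N) :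
    ∃ (r : ℝ) (χ : EuclideanSpace ℝ (Fin 4) → M) (Mb : ℝ → Matrix (Fin 3) (Fin 3) ℝ),
      0 < r ∧
      (∀ q, χ (q + (2 * π) • EuclideanSpace.single 0 1) = χ q) ∧
      ContMDiffOn 𝓘(ℝ, EuclideanSpace ℝ (Fin 4)) (𝓡 4) ∞ χ (hondaTube r) ∧
      (∀ q ∈ hondaTube r, ∀ q' ∈ hondaTube r, χ q' = χ q →
        ∃ k : ℤ, q' = q + (2 * π * k) • EuclideanSpace.single 0 1) ∧
      (∀ q ∈ hondaTube r, Injective (mfderiv 𝓘(ℝ, EuclideanSpace ℝ (Fin 4)) (𝓡 4) χ q)) ∧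
      χ '' hondaTube r ⊆ N ∧
      χ '' hondaAxis = range γ ∧
      zeroLocus sf ∩ χ '' hondaTube r = χ '' hondaAxis ∧
      (∀ i j, ContDiff ℝ ∞ fun θ ↦ Mb θ i j) ∧ (∀ θ, (Mb θ).IsSymm) ∧
      (∀ θ (m : Fin 3), Mb θ m 2 = if m = 2 then Mb θ 2 2 else 0) ∧ (∀ θ, Mb θ 2 2 < 0) ∧
      (∀ θ (v : Fin 3 → ℝ), v 2 = 0 → v ≠ 0 → 0 < v ⬝ᵥ Mb θ *ᵥ v) ∧
      (∀ θ, Mb (θ + 2 * π) = Mb θ) ∧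
      ∀ θ W, fderiv ℝ (fun y ↦ (sf.pullback 𝓘(ℝ, EuclideanSpace ℝ (Fin 4)) χ y :
          (EuclideanSpace ℝ (Fin 4)) [⋀^Fin 2]→L[ℝ] ℝ)) (hondaAxisPoint θ) W =
        betaForm (Mb θ *ᵥ normalPart W) := by
  obtain ⟨r, χ, σ, Mb, hr, hper, hχs, hχinj, hχimm, hχN, -, hax, hZ, hMs, hσ, hsymm, hblock,
    hneg, hpos, hMP, hjet⟩ := h.exists_adaptedChart o hsf hN hγN
  have hjetF := fderiv_pullback_axis_eq_of_zeroGradient hjet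
  rcases hσ with hσ1 | hσ1
  · -- sign already `+`
    refine ⟨r, χ, Mb, hr, hper, hχs, hχinj, hχimm, hχN, hax, hZ, hMs, hsymm, hblock, hneg, hpos,
      hMP, fun θ W ↦ ?_⟩
    rw [hjetF, hσ1]
    congr 1
    funext k
    rw [one_mul]
  · -- sign `−`: precompose with the reflection `ι`
    obtain ⟨ι, hι⟩ := exists_hondaReflectCLM
    set π₁ : Equiv.Perm (Fin 3) := Equiv.swap (0 : Fin 3) 1 with hπ₁
    set Mb' : ℝ → Matrix (Fin 3) (Fin 3) ℝ := fun θ ↦ (Mb (-θ)).submatrix π₁ π₁ with hMb'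
    have hopen := isOpen_hondaTube r
    have hsm : IsSmoothForm sf := hsf.isSmoothForm
    -- differentiability of `χ` and of `ι`
    have hχd : ∀ q ∈ hondaTube r,
        MDifferentiableAt 𝓘(ℝ, EuclideanSpace ℝ (Fin 4)) (𝓡 4) χ q := fun q hq ↦
      ((hχs q hq).contMDiffAt (hopen.mem_nhds hq)).mdifferentiableAt (by simp)
    have hιd : ∀ q, HasMFDerivAt 𝓘(ℝ, EuclideanSpace ℝ (Fin 4)) 𝓘(ℝ, EuclideanSpace ℝ (Fin 4))
        ι q ι := fun q ↦ ι.hasMFDerivAt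
    have hcomp : ∀ q ∈ hondaTube r,
        mfderiv 𝓘(ℝ, EuclideanSpace ℝ (Fin 4)) (𝓡 4) (χ ∘ ι) q =
          (mfderiv 𝓘(ℝ, EuclideanSpace ℝ (Fin 4)) (𝓡 4) χ (ι q)).comp ι := by
      intro q hq
      have hq' : ι q ∈ hondaTube r := (reflect_mem_hondaTube_iff hι).2 hq
      rw [mfderiv_comp q (hχd _ hq') (hιd q).mdifferentiableAt, (hιd q).mfderiv]
      rfl
    refine ⟨r, χ ∘ ι, Mb', hr, ?_, ?_, ?_, ?_, ?_, ?_, ?_, ?_, ?_, ?_, ?_, ?_, ?_, ?_⟩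
    · -- periodic
      intro q
      simp only [Function.comp_apply]
      rw [reflect_add_smul hι]
      have h1 := hper (ι q + (-(2 * π)) • EuclideanSpace.single 0 1)
      rw [neg_smul, neg_add_cancel_right] at h1
      rw [neg_smul]
      exact h1.symm
    · -- smooth on the tube
      exact hχs.comp ι.contMDiff.contMDiffOn fun q hq ↦ (reflect_mem_hondaTube_iff hι).2 hq
    · -- injective modulo the period
      intro q hq q' hq' heq
      obtain ⟨k, hk⟩ := hχinj (ι q) ((reflect_mem_hondaTube_iff hι).2 hq) (ι q')
        ((reflect_mem_hondaTube_iff hι).2 hq') heq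
      refine ⟨-k, ?_⟩
      have h1 : q' = ι (ι q + (2 * π * k) • EuclideanSpace.single 0 1) := by
        rw [← hk, reflect_reflect hι]
      rw [h1, reflect_add_smul hι, reflect_reflect hι]
      congr 1
      push_cast
      ring_nf
    · -- immersion
      intro q hq v w hvw
      have key := hcomp q hq
      have hv := congrArg (fun L : EuclideanSpace ℝ (Fin 4) →L[ℝ] EuclideanSpace ℝ (Fin 4) ↦ L v) key
      have hw := congrArg (fun L : EuclideanSpace ℝ (Fin 4) →L[ℝ] EuclideanSpace ℝ (Fin 4) ↦ L w) key
      refine reflect_injective hι (hχimm (ι q) ((reflect_mem_hondaTube_iff hι).2 hq) ?_)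
      have h1 : mfderiv 𝓘(ℝ, EuclideanSpace ℝ (Fin 4)) (𝓡 4) χ (ι q) (ι v) =
          mfderiv 𝓘(ℝ, EuclideanSpace ℝ (Fin 4)) (𝓡 4) (χ ∘ ι) q v := hv.symm
      have h2 : mfderiv 𝓘(ℝ, EuclideanSpace ℝ (Fin 4)) (𝓡 4) χ (ι q) (ι w) =
          mfderiv 𝓘(ℝ, EuclideanSpace ℝ (Fin 4)) (𝓡 4) (χ ∘ ι) q w := hw.symm
      rw [h1, h2]
      exact hvw
    · -- image in `N`
      rw [image_comp_reflect hι χ fun q ↦ reflect_mem_hondaTube_iff hι]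
      exact hχN
    · -- axis image
      rw [image_comp_reflect hι χ fun q ↦ reflect_mem_hondaAxis_iff hι]
      exact hax
    · -- zeros on the tube
      rw [image_comp_reflect hι χ fun q ↦ reflect_mem_hondaTube_iff hι,
        image_comp_reflect hι χ fun q ↦ reflect_mem_hondaAxis_iff hι]
      exact hZ
    · -- smooth entries
      intro i j
      simp only [hMb', Matrix.submatrix_apply]
      exact (hMs _ _).comp contDiff_neg
    · -- symmetric
      intro θ
      exact (hsymm (-θ)).submatrix _
    · -- block
      intro θ m
      exact reflectBlock_block hblock θ m
    · -- negative corner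
      intro θ
      have hs2 : π₁ 2 = 2 := Equiv.swap_apply_of_ne_of_ne (by decide) (by decide)
      simp only [hMb', Matrix.submatrix_apply, hs2]
      exact hneg (-θ)
    · -- positive block
      intro θ v hv2 hv0
      rw [dotProduct_reflectBlock_mulVec]
      refine hpos (-θ) (v ∘ π₁) ?_ ?_
      · have hs2 : π₁ 2 = 2 := Equiv.swap_apply_of_ne_of_ne (by decide) (by decide)
        simp only [Function.comp_apply, hs2, hv2]
      · intro h0
        apply hv0
        funext i
        have := congrFun h0 (π₁ i)
        simpa [hπ₁, Equiv.swap_apply_self] using this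
    · -- periodic family
      intro θ
      have h1 := hMP (-(θ + 2 * π))
      rw [show -(θ + 2 * π) + 2 * π = -θ by ring] at h1
      simp only [hMb', h1]
    · -- the jet, sign `+`
      intro θ W
      -- `(χ ∘ ι)^*ω = ι^*(χ^*ω)` on the tube
      set G : EuclideanSpace ℝ (Fin 4) → (EuclideanSpace ℝ (Fin 4)) [⋀^Fin 2]→L[ℝ] ℝ :=
        fun y ↦ sf.pullback 𝓘(ℝ, EuclideanSpace ℝ (Fin 4)) χ y with hG
      have hGs : ContDiffOn ℝ ∞ G (hondaTube r) := contDiffOn_pullback_hondaTube hχs hsm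
      have hev : (fun y ↦ (sf.pullback 𝓘(ℝ, EuclideanSpace ℝ (Fin 4)) (χ ∘ ι) y :
          (EuclideanSpace ℝ (Fin 4)) [⋀^Fin 2]→L[ℝ] ℝ)) =ᶠ[𝓝 (hondaAxisPoint θ)]
          fun y ↦ ContinuousAlternatingMap.compContinuousLinearMapCLM ι (G (ι y)) := by
        filter_upwards [hopen.mem_nhds (hondaAxisPoint_mem_hondaTube hr θ)] with y hy
        ext v
        change sf.pullback 𝓘(ℝ, EuclideanSpace ℝ (Fin 4)) (χ ∘ ι) y v = G (ι y) (ι ∘ v)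
        simp only [hG, MForm.pullback_apply, Function.comp_apply]
        have key := hcomp y hy
        exact congrArg (sf (χ (ι y))) (funext fun i ↦
          congrArg (fun L : EuclideanSpace ℝ (Fin 4) →L[ℝ] EuclideanSpace ℝ (Fin 4) ↦ L (v i)) key)
      rw [hev.fderiv_eq]
      have hι0 : ι (hondaAxisPoint θ) = hondaAxisPoint (-θ) := reflect_hondaAxisPoint hι θ
      have hGd : DifferentiableAt ℝ G (ι (hondaAxisPoint θ)) := by
        rw [hι0]
        exact (hGs.contDiffAt (hopen.mem_nhds (hondaAxisPoint_mem_hondaTube hr _))).differentiableAt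
          (by simp)
      set L : ((EuclideanSpace ℝ (Fin 4)) [⋀^Fin 2]→L[ℝ] ℝ) →L[ℝ]
          ((EuclideanSpace ℝ (Fin 4)) [⋀^Fin 2]→L[ℝ] ℝ) :=
        ContinuousAlternatingMap.compContinuousLinearMapCLM ι with hL
      have hD : HasFDerivAt (⇑L ∘ G ∘ ⇑ι) (L.comp ((fderiv ℝ G (ι (hondaAxisPoint θ))).comp ι))
          (hondaAxisPoint θ) :=
        L.hasFDerivAt.comp _ (hGd.hasFDerivAt.comp _ ι.hasFDerivAt)
      rw [show (fun y ↦ L (G (ι y))) = ⇑L ∘ G ∘ ⇑ι from rfl, hD.fderiv,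
        ContinuousLinearMap.comp_apply, ContinuousLinearMap.comp_apply, hι0, hjetF, hσ1, hL,
        ContinuousAlternatingMap.compContinuousLinearMapCLM_apply,
        betaForm_compContinuousLinearMap_reflect hι, normalPart_reflect hι]
      have hfun : (fun k ↦ (-1 : ℝ) * (Mb (-θ) *ᵥ (normalPart W ∘ ⇑(Equiv.swap (0 : Fin 3) 1))) k) ∘
          ⇑(Equiv.swap (0 : Fin 3) 1) = -(Mb' θ *ᵥ normalPart W) := by
        simp only [hMb']
        rw [Matrix.submatrix_mulVec_equiv, Equiv.symm_swap]
        funext k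
        simp [hπ₁]
      rw [hfun, betaForm_neg, neg_neg]

end Literature.Geometry.Symplectic

end
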